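import Literature.NumberTheory.Automorphic.ArchRankOneSplitOrbitContinuity          -- ★ FILE 2 (p850189): the (A0) head in `K × N` currency (brings ★ FILE 1)
import Literature.NumberTheory.Automorphic.ArchRankOneSplitIwasawa                  -- ★ (IWA) (p850256): the circle `K₁`, `U(Φ₂)(ℂ) = K₁·B`, Haar of `K₁` = image of `ds`, the unipotent cone through `K₁`
import Literature.NumberTheory.Automorphic.ArchRankOneSplitConeChart                -- ★ (A0-c) chart half (p850302): `∫_{ℝ∕2πℤ×ℝ} f(z(1 + iu·A(s))) = 2·(cone⁺ + cone⁻)`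
import Literature.NumberTheory.Rogawski1990.ArchHyperbolicOrbitProperTwo            -- ★ `isCompact_setOf_forall_norm_le₂` (the inclusion `U(Φ₂)(ℂ) → M₂(ℂ)` is proper)
import HarnessLib

/-!
# (A0-c) THE SPLIT SIDE OF THE CENTRAL WALL OF `U(Φ₂)(ℂ)` IN (K0±) HALF-CONE CURRENCY — binder-free:
# `|eˣ − e⁻ˣ| • ∫_{G ⧸ T} f(y · hypBlockGL x θ · y⁻¹) dμ(y) ⟶ C₂ • [cone⁺(f, e^{iθ}) + cone⁻(f, e^{iθ})]`, `C₂ > 0` depending only on `μ`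

Topic `NumberTheory/Automorphic`; namespace `Literature.NumberTheory.Automorphic.UnitaryGroup`.  KERNEL mathematics only: theorems, no definition, no named fact,
no instance, no notation, no `sorry`.  Cell `pub/hodgecm-mathlib`, line LH3 (closer stub `stub_N9`, crux H413 = `stmt-HodgeConjecture-24833`), DIRECT ROAD brick **(A0-c),
GROUP HALF** (pen F0P3a-p05 (g19); LH3-plan (g3) 2026-09-02T07:24:10Z caveat (c3) «state the (A0) value as `C₂·(cone⁺ + cone⁻)`»; LH10-p02 (g3)'s (J-H) head ★
`ArchBouazizStableFamilyJumpZero` reads the elliptic side in exactly this currency).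

THE MATHEMATICS.  `G = U(conj, J)(ℂ)`, `J = Φ₂` (a VARIABLE with `hJ : J = (StdForm.antidiagonal 2).over ℂ`, so `archLocal L 2 Φ₂ w` qualifies), `T = torusU` the split Cartan,
`μ` ANY non-zero `G`-invariant Radon measure on `G ⧸ T`.  CHOICES (internal to the proof): `K = K₁ = {k_s}` the circle of ★ (IWA) with Haar measure `κ = (s ↦ k_s)_* ds`
(★ `isHaarMeasure_map_rotLift`), `N = unipotentU` with Haar measure `μ_N = (u ↦ n_{iu})_* du` through the line chart `n_y = [[1, y], [0, 1]]` (★ `exists_lineChart`; §1: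
this image measure IS a Haar measure of `N` — translation invariance of `du`, properness and surjectivity of the chart).  Then ★ FILE 1 gives `C > 0` with
`μ = C • ((k, n) ↦ k n T)_*(κ ⊗ μ_N)` (`U(Φ₂)(ℂ) = K₁·B`, ★ `exists_rotLift_mul_mem_borelU`), ★ FILE 2 gives, for `F = f ∘ (g ↦ g)` (`f` continuous with compact support on
`M₂(ℂ)`; `F` has compact support on `G` because the inclusion is proper, ★ `isCompact_setOf_forall_norm_le₂`),
`|eˣ − e⁻ˣ| • ∫_{G ⧸ T} F(y · hypBlockGL x θ · y⁻¹) dμ → C • ∫_{K₁ × N} F(e^{iθ} · k n k⁻¹) d(κ ⊗ μ_N)` as `x → 0`, `x ≠ 0`, and in the coordinates `(s, u)`: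
`∫_{K₁ × N} F(e^{iθ} · k n k⁻¹) = ∫_{ℝ∕2πℤ × ℝ} f(e^{iθ} · (1 + iu · A(s))) d(s,u)` (★ `coe_rotLift_mul_unipotent_mul_inv`: `k_s n_{iu} k_s⁻¹ = 1 + iu·A(s)`,
`A(s) = (i sin s cos s, cos² s; sin² s, −i sin s cos s)`) `= 2 · [cone⁺(f, e^{iθ}) + cone⁻(f, e^{iθ})]` (★ (A0-c) chart half `integral_addCircle_prod_coneChart_eq_two_smul_cone`,
the half-angle identity `Ad(k_{θ′∕2})E₀₁ = ½ P M(θ′) P⁻¹`).  HEAD (§2):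
  **`∃ C₂ > 0, ∀ f θ, |eˣ − e⁻ˣ| • ∫_{G ⧸ T} f(↑↑(y · hypBlockGL x θ · y⁻¹)) dμ(y) ⟶ C₂ • [cone⁺(f, e^{iθ}) + cone⁻(f, e^{iθ})]`  (`x → 0`, `x ≠ 0`)**,
`cone^±(f, z) = ∫_{τ>0, θ′∈(0,2π]} f(P(z·1 ± τ·diag(zi,−zi) + τ·W^± θ′)·½P)` VERBATIM the half-cone integrals of ★ `exists_tendsto_two_sin_smul_orbitalIntegral_cayley_nhdsGT_nhdsLT`
∕ ★ `exists_hasOneSidedJump_two_sin_mul_orbitalIntegral_cayley` at `z = e^{iθ}` — Harish-Chandra's «`F_f^A(z·1)` = Rao's two-nappe cone integral = the JUMP of `F_f^B`»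
for `U(1,1)`, both sides now in ONE currency (the (J-H) constant is `cH = 2i·C₁ ∕ C₂` up to the (PROD-QUOT-H) box normalisations).
HONEST LABEL: HC_CM is proved only modulo the 7 printed citations (2 remaining: hLiu418 = stmt-HodgeConjecture-24832, h413 = stmt-HodgeConjecture-24833) until rung 0 closes;
measure theory over Mathlib + ★ kit, count-neutral, pays nothing by itself.

## References
* [Varadarajan1989] V. S. Varadarajan, *An Introduction to Harmonic Analysis on Semisimple Lie Groups*, Cambridge Stud. Adv. Math. 16 (1989), §6.4 Lemma 21, Thm 23.
* [Shelstad1979] D. Shelstad, *Characters and inner forms of a quasi-split group over ℝ*, Compositio Math. 39 (1979), Lemma 4.3 p. 25.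
* [Rogawski1990] J. D. Rogawski, *Automorphic Representations of Unitary Groups in Three Variables*, Ann. of Math. Stud. 123 (1990), §3.1 p. 19, §8.2 pp. 119, 122.
* [Gelbart1975] S. Gelbart, *Automorphic Forms on Adele Groups*, Ann. of Math. Stud. 83, Thm. 9.22 (iii). -/

set_option autoImplicit false

noncomputable section

open MeasureTheory Measure Set Filter Topology
open scoped ENNReal NNReal ComplexConjugate Real MatrixGroups Matrix

namespace Literature.NumberTheory.Automorphic

open Literature.MeasureTheory.Group

namespace UnitaryGroup

open Literature.NumberTheory.Rogawski1990
open Literature.NumberTheory.Automorphic.UnitaryGroup.HeisRing Literature.NumberTheory.Automorphic.UnitaryGroup.LineRing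

section ConeMatching

variable {J : Matrix (Fin 2) (Fin 2) ℂ} (hJ : J = (StdForm.antidiagonal 2).over ℂ)

/-! ## §1 Plumbing: the scalar block, compact support of `f ∘ (g ↦ g)`, and the line chart `u ↦ n_{iu}` carries `du` to a Haar measure of `N` -/

/-- `hypBlockGL 0 θ = e^{iθ} · 1`. [cite: Rogawski1990, §3.6 p. 31] -/
theorem coe_hypBlockGL_zero_left (θ : ℝ) :
    ((hypBlockGL 0 θ : GL (Fin 2) ℂ) : Matrix (Fin 2) (Fin 2) ℂ) = Complex.exp ((θ : ℂ) * Complex.I) • (1 : Matrix (Fin 2) (Fin 2) ℂ) := by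
  rw [coe_hypBlockGL]
  ext i j
  fin_cases i <;> fin_cases j <;> simp

include hJ in
/-- **`f ∘ (g ↦ g)` HAS COMPACT SUPPORT ON `U(Φ₂)(ℂ)`** when `f` has compact support on `M₂(ℂ)`: the inclusion is proper (★ `isCompact_setOf_forall_norm_le₂`).
[cite: Rogawski1990, §3.1 p. 19; §8.3 p. 122] -/
theorem hasCompactSupport_comp_coe {E : Type*} [NormedAddCommGroup E] (f : Matrix (Fin 2) (Fin 2) ℂ → E) (hfc : HasCompactSupport f) :
    HasCompactSupport fun g : ↥(unitaryGroupOfForm (starRingEnd ℂ) J) => f ((g : GL (Fin 2) ℂ) : Matrix (Fin 2) (Fin 2) ℂ) := by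
  have hb : ∀ i j : Fin 2, ∃ ρ : ℝ, ∀ M ∈ tsupport f, ‖M i j‖ ≤ ρ := by
    intro i j
    obtain ⟨ρ, hρ⟩ := (hfc.isCompact.image (continuous_id.matrix_elem i j)).isBounded.exists_norm_le
    exact ⟨ρ, fun M hM => hρ _ ⟨M, hM, rfl⟩⟩
  choose ρ hρ using hb
  refine HasCompactSupport.intro (isCompact_setOf_forall_norm_le₂ (hJ.trans (StdForm.over_antidiagonal_eq ℂ)) (∑ i, ∑ j, |ρ i j|)) fun g hg => ?_
  apply image_eq_zero_of_notMem_tsupport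
  intro hmem
  apply hg
  intro i j
  refine (hρ i j _ hmem).trans ((le_abs_self _).trans ?_)
  calc |ρ i j| ≤ ∑ j', |ρ i j'| := Finset.single_le_sum (f := fun j' => |ρ i j'|) (fun _ _ => abs_nonneg _) (Finset.mem_univ j)
    _ ≤ ∑ i', ∑ j', |ρ i' j'| := Finset.single_le_sum (f := fun i' => ∑ j', |ρ i' j'|) (fun _ _ => Finset.sum_nonneg fun _ _ => abs_nonneg _) (Finset.mem_univ i)

/-- `iu ∈ iℝ = R⁻` for `σ = conj` on `ℂ`. [cite: Rogawski1990, §3.1 p. 19] -/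
theorem ofReal_mul_I_mem_skewPart (u : ℝ) : ((u : ℂ) * Complex.I) ∈ HeisRing.skewPart (starRingEnd ℂ) := by
  rw [HeisRing.mem_skewPart_iff, map_mul, Complex.conj_ofReal, Complex.conj_I, mul_neg]

include hJ in
/-- **THE LINE CHART `u ↦ n_{iu}` CARRIES LEBESGUE MEASURE `du` TO A HAAR MEASURE OF `N ≤ U(Φ₂)(ℂ)`** (existence, packaged with its three working properties): there is a
continuous `ψ : ℝ → N` with `ψ(u + v) = ψ u · ψ v`, `(ψ u)₀₁ = iu`, whose image of `du` is a Haar measure of `N` (left invariance from translation invariance of `du`;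
finite on compacts since `|u| = |(ψ u)₀₁|` is bounded on a compact; positive on opens since `ψ` is continuous ONTO `N`, every `y ∈ iℝ` being `i · Im y`).
[cite: Rogawski1990, §3.1 p. 19; §4.9 p. 55] [cite: Gelbart1975, Thm. 9.22 (iii)] -/
theorem exists_lineChart_real_isHaarMeasure_map [MeasurableSpace ↥(unitaryGroupOfForm (starRingEnd ℂ) J)] [BorelSpace ↥(unitaryGroupOfForm (starRingEnd ℂ) J)] :
    ∃ ψ : ℝ → ↥(unipotentU (starRingEnd ℂ) J), Continuous ψ ∧ (∀ u v, ψ (u + v) = ψ u * ψ v) ∧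
      (∀ u, ((((ψ u : ↥(unipotentU (starRingEnd ℂ) J)) : ↥(unitaryGroupOfForm (starRingEnd ℂ) J)) : GL (Fin 2) ℂ) : Matrix (Fin 2) (Fin 2) ℂ) 0 1 =
        (u : ℂ) * Complex.I) ∧
      IsHaarMeasure (Measure.map ψ (volume : Measure ℝ)) := by
  haveI : BorelSpace ↥(unipotentU (starRingEnd ℂ) J) := Subtype.borelSpace _
  obtain ⟨e, he, hadd⟩ := exists_lineChart (starRingEnd ℂ) hJ
  set ψ : ℝ → ↥(unipotentU (starRingEnd ℂ) J) := fun u => e ⟨(u : ℂ) * Complex.I, ofReal_mul_I_mem_skewPart u⟩ with hψ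
  have hψc : Continuous ψ := e.continuous.comp ((Complex.continuous_ofReal.mul continuous_const).subtype_mk _)
  have hψm : Measurable ψ := hψc.measurable
  have hψadd : ∀ u v, ψ (u + v) = ψ u * ψ v := by
    intro u v
    simp only [hψ]
    rw [← hadd]
    congr 1
    apply Subtype.ext
    change (((u + v : ℝ) : ℂ)) * Complex.I = (u : ℂ) * Complex.I + (v : ℂ) * Complex.I
    push_cast
    ring
  have hψ01 : ∀ u, ((((ψ u : ↥(unipotentU (starRingEnd ℂ) J)) : ↥(unitaryGroupOfForm (starRingEnd ℂ) J)) : GL (Fin 2) ℂ) :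
      Matrix (Fin 2) (Fin 2) ℂ) 0 1 = (u : ℂ) * Complex.I := fun u => he _
  have hψsurj : Function.Surjective ψ := by
    intro n
    have hy : (starRingEnd ℂ) ((e.symm n : ↥(HeisRing.skewPart (starRingEnd ℂ))) : ℂ) = -((e.symm n : ↥(HeisRing.skewPart (starRingEnd ℂ))) : ℂ) :=
      (e.symm n).2
    have hre : ((e.symm n : ↥(HeisRing.skewPart (starRingEnd ℂ))) : ℂ).re = 0 := by
      have h := congrArg Complex.re hy
      rw [Complex.conj_re, Complex.neg_re] at h
      linarith
    refine ⟨((e.symm n : ↥(HeisRing.skewPart (starRingEnd ℂ))) : ℂ).im, ?_⟩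
    have hpt : (⟨((((e.symm n : ↥(HeisRing.skewPart (starRingEnd ℂ))) : ℂ).im : ℝ) : ℂ) * Complex.I, ofReal_mul_I_mem_skewPart _⟩ :
        ↥(HeisRing.skewPart (starRingEnd ℂ))) = e.symm n := by
      apply Subtype.ext
      apply Complex.ext
      · simp [hre]
      · simp
    simp only [hψ]
    rw [hpt, Homeomorph.apply_symm_apply]
  have hleft : (Measure.map ψ (volume : Measure ℝ)).IsMulLeftInvariant := by
    refine ⟨fun n => ?_⟩
    obtain ⟨u₀, rfl⟩ := hψsurj n
    rw [Measure.map_map (measurable_const_mul _) hψm]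
    have hcomp : (fun x : ↥(unipotentU (starRingEnd ℂ) J) => ψ u₀ * x) ∘ ψ = ψ ∘ fun u => u₀ + u := by
      funext u; simp only [Function.comp_apply, hψadd]
    rw [hcomp, ← Measure.map_map hψm (measurable_const_add u₀), map_add_left_eq_self]
  have hfin : ∀ C : Set ↥(unipotentU (starRingEnd ℂ) J), IsCompact C → Measure.map ψ (volume : Measure ℝ) C < ⊤ := by
    intro C hC
    -- the `(0,1)` entry is bounded on the compact `C`, so `ψ⁻¹ C ⊆ [−ρ, ρ]`
    have hcont : Continuous fun n : ↥(unipotentU (starRingEnd ℂ) J) =>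
        ((((n : ↥(unitaryGroupOfForm (starRingEnd ℂ) J)) : GL (Fin 2) ℂ) : Matrix (Fin 2) (Fin 2) ℂ) 0 1) :=
      (Units.continuous_val.comp (continuous_subtype_val.comp continuous_subtype_val)).matrix_elem 0 1
    obtain ⟨ρ, hρ⟩ := (hC.image hcont).isBounded.exists_norm_le
    rw [Measure.map_apply hψm hC.measurableSet]
    refine lt_of_le_of_lt (measure_mono fun u hu => ?_) (measure_Icc_lt_top (a := -ρ) (b := ρ))
    have h : ‖((((ψ u : ↥(unipotentU (starRingEnd ℂ) J)) : ↥(unitaryGroupOfForm (starRingEnd ℂ) J)) : GL (Fin 2) ℂ) : Matrix (Fin 2) (Fin 2) ℂ) 0 1‖ ≤ ρ :=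
      hρ _ ⟨ψ u, hu, rfl⟩
    rw [hψ01, norm_mul, Complex.norm_I, mul_one, Complex.norm_real, Real.norm_eq_abs] at h
    exact abs_le.1 h
  have hpos : (Measure.map ψ (volume : Measure ℝ)).IsOpenPosMeasure := by
    refine ⟨fun U hU hne => ?_⟩
    rw [Measure.map_apply hψm hU.measurableSet]
    obtain ⟨n, hn⟩ := hne
    obtain ⟨u, rfl⟩ := hψsurj n
    exact ((hU.preimage hψc).measure_pos volume ⟨u, hn⟩).ne'
  exact ⟨ψ, hψc, hψadd, hψ01, { toIsMulLeftInvariant := hleft, lt_top_of_isCompact := hfin, toIsOpenPosMeasure := hpos }⟩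

/-! ## §2 The head: the (A0) limit in (K0±) half-cone currency, binder-free -/

include hJ in
/-- **(A0-c) HEAD — THE SPLIT-SIDE LIMIT AT THE CENTRAL WALL IN HALF-CONE CURRENCY.**  For EVERY non-zero `G`-invariant Radon measure `μ` on `U(Φ₂)(ℂ) ⧸ T` there is
`C₂ > 0` such that for every continuous compactly supported `f : M₂(ℂ) → E` and every `θ`, as `x → 0`, `x ≠ 0`:
**`|eˣ − e⁻ˣ| • ∫_{G ⧸ T} f(↑↑(y · hypBlockGL x θ · y⁻¹)) dμ(y) ⟶ C₂ • [cone⁺(f, e^{iθ}) + cone⁻(f, e^{iθ})]`**, the two half-cone integrals being VERBATIM those of ★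
`exists_tendsto_two_sin_smul_orbitalIntegral_cayley_nhdsGT_nhdsLT` at `z = e^{iθ}` — Harish-Chandra: `F_f^A` extends continuously to the centre with value Rao's
two-nappe cone integral, i.e. the JUMP of `F_f^B` (★ (K0±)). [cite: Varadarajan1989, §6.4 Lemma 21, Thm 23] [cite: Shelstad1979, Lemma 4.3 p. 25] [cite: Rogawski1990, §8.2 pp. 119, 122] -/
theorem exists_tendsto_abs_sub_smul_integral_descConj_hypBlockGL_cone [Fact (0 < 2 * π)]
    [MeasurableSpace ↥(unitaryGroupOfForm (starRingEnd ℂ) J)] [BorelSpace ↥(unitaryGroupOfForm (starRingEnd ℂ) J)]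
    [MeasurableSpace (↥(unitaryGroupOfForm (starRingEnd ℂ) J) ⧸ torusU (starRingEnd ℂ) J)]
    [BorelSpace (↥(unitaryGroupOfForm (starRingEnd ℂ) J) ⧸ torusU (starRingEnd ℂ) J)]
    (μ : Measure (↥(unitaryGroupOfForm (starRingEnd ℂ) J) ⧸ torusU (starRingEnd ℂ) J))
    [SMulInvariantMeasure ↥(unitaryGroupOfForm (starRingEnd ℂ) J) (↥(unitaryGroupOfForm (starRingEnd ℂ) J) ⧸ torusU (starRingEnd ℂ) J) μ]
    [IsFiniteMeasureOnCompacts μ] (hμ : μ ≠ 0) {E : Type*} [NormedAddCommGroup E] [NormedSpace ℝ E] :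
    ∃ C₂ : ℝ, 0 < C₂ ∧ ∀ (f : Matrix (Fin 2) (Fin 2) ℂ → E), Continuous f → HasCompactSupport f → ∀ θ : ℝ,
      Tendsto (fun x : ℝ => |Real.exp x - Real.exp (-x)| •
          ∫ y, descConj (⟨hypBlockGL x θ, hypBlockGL_mem_of_eq_over hJ x θ⟩ : ↥(unitaryGroupOfForm (starRingEnd ℂ) J)) (torusU (starRingEnd ℂ) J)
            (LineRing.forall_mem_torusU_comm (starRingEnd ℂ) J (hypBlockGL_mem_torusU hJ x θ))
            (fun g : ↥(unitaryGroupOfForm (starRingEnd ℂ) J) => f ((g : GL (Fin 2) ℂ) : Matrix (Fin 2) (Fin 2) ℂ)) y ∂μ)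
        (𝓝[≠] 0)
        (𝓝 (C₂ • ((∫ p in Ioi (0 : ℝ) ×ˢ Ioc (0 : ℝ) (2 * π),
            f ((!![(1 : ℂ), 1; 1, -1] : Matrix (Fin 2) (Fin 2) ℂ) *
              (Complex.exp ((θ : ℂ) * Complex.I) • (1 : Matrix (Fin 2) (Fin 2) ℂ) +
                p.1 • Matrix.diagonal ![Complex.exp ((θ : ℂ) * Complex.I) * Complex.I, -(Complex.exp ((θ : ℂ) * Complex.I) * Complex.I)] +
                p.1 • !![(0 : ℂ), -(Complex.exp ((θ : ℂ) * Complex.I) * Complex.I) * Complex.exp (-((p.2 : ℂ) * Complex.I));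
                  (Complex.exp ((θ : ℂ) * Complex.I) * Complex.I) * Complex.exp ((p.2 : ℂ) * Complex.I), 0]) *
              !![(1 / 2 : ℂ), 1 / 2; 1 / 2, -(1 / 2)])) +
          ∫ p in Ioi (0 : ℝ) ×ˢ Ioc (0 : ℝ) (2 * π),
            f ((!![(1 : ℂ), 1; 1, -1] : Matrix (Fin 2) (Fin 2) ℂ) *
              (Complex.exp ((θ : ℂ) * Complex.I) • (1 : Matrix (Fin 2) (Fin 2) ℂ) +
                p.1 • Matrix.diagonal ![-(Complex.exp ((θ : ℂ) * Complex.I) * Complex.I), Complex.exp ((θ : ℂ) * Complex.I) * Complex.I] +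
                p.1 • !![(0 : ℂ), (Complex.exp ((θ : ℂ) * Complex.I) * Complex.I) * Complex.exp (-((p.2 : ℂ) * Complex.I));
                  -(Complex.exp ((θ : ℂ) * Complex.I) * Complex.I) * Complex.exp ((p.2 : ℂ) * Complex.I), 0]) *
              !![(1 / 2 : ℂ), 1 / 2; 1 / 2, -(1 / 2)])))) := by
  -- instances on `G`, `T`, `N`
  haveI : LocallyCompactSpace ↥(unitaryGroupOfForm (starRingEnd ℂ) J) := locallyCompactSpace_unitaryGroupOfForm_complex J
  haveI : SecondCountableTopology ↥(unitaryGroupOfForm (starRingEnd ℂ) J) := secondCountableTopology_unitaryGroupOfForm_complex J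
  have hT : IsClosed (torusU (starRingEnd ℂ) J : Set ↥(unitaryGroupOfForm (starRingEnd ℂ) J)) := isClosed_torusU_two _ _
  have hN : IsClosed (unipotentU (starRingEnd ℂ) J : Set ↥(unitaryGroupOfForm (starRingEnd ℂ) J)) := isClosed_unipotentU _ _
  haveI : LocallyCompactSpace ↥(torusU (starRingEnd ℂ) J) := hT.isClosedEmbedding_subtypeVal.locallyCompactSpace
  haveI : LocallyCompactSpace ↥(unipotentU (starRingEnd ℂ) J) := hN.isClosedEmbedding_subtypeVal.locallyCompactSpace
  haveI : SecondCountableTopology ↥(unipotentU (starRingEnd ℂ) J) := TopologicalSpace.Subtype.secondCountableTopology _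
  haveI : BorelSpace ↥(torusU (starRingEnd ℂ) J) := Subtype.borelSpace _
  haveI : BorelSpace ↥(unipotentU (starRingEnd ℂ) J) := Subtype.borelSpace _
  -- the circle `K₁` as a subgroup, compact, with `G = K₁ · B`
  set ι : AddCircle (2 * π) → ↥(unitaryGroupOfForm (starRingEnd ℂ) J) :=
    fun s => ⟨archPlaneLiftGL 1 (rotMat s) (det_rotMat s), archPlaneLiftGL_rotMat_mem hJ s⟩ with hι
  have hιadd : ∀ s t, ι (s + t) = ι s * ι t := fun s t => Subtype.ext (archPlaneLiftGL_rotMat_add s t)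
  have hι0 : ι 0 = 1 := Subtype.ext archPlaneLiftGL_rotMat_zero
  have hιneg : ∀ s, ι (-s) = (ι s)⁻¹ := fun s => Subtype.ext (by
    rw [Subgroup.coe_inv]; exact archPlaneLiftGL_rotMat_neg s)
  let K : Subgroup ↥(unitaryGroupOfForm (starRingEnd ℂ) J) :=
    { carrier := Set.range ι
      one_mem' := ⟨0, hι0⟩
      mul_mem' := by
        rintro _ _ ⟨s, rfl⟩ ⟨t, rfl⟩
        exact ⟨s + t, hιadd s t⟩
      inv_mem' := by
        rintro _ ⟨s, rfl⟩
        exact ⟨-s, hιneg s⟩ }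
  have hKmem : ∀ s, ι s ∈ K := fun s => ⟨s, rfl⟩
  have hKmem' : ∀ k ∈ K, ∃ s, k = ι s := fun k ⟨s, hs⟩ => ⟨s, hs.symm⟩
  have hK : IsCompact (K : Set ↥(unitaryGroupOfForm (starRingEnd ℂ) J)) := isCompact_range_rotLift hJ
  have hKB : ∀ g : ↥(unitaryGroupOfForm (starRingEnd ℂ) J), ∃ k ∈ K, ∃ b ∈ borelU (starRingEnd ℂ) J, g = k * b := by
    intro g
    obtain ⟨s, b, hb, hg⟩ := exists_rotLift_mul_mem_borelU hJ g
    exact ⟨ι s, hKmem s, b, hb, hg⟩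
  haveI : CompactSpace ↥K := isCompact_iff_compactSpace.1 hK
  haveI : BorelSpace ↥K := Subtype.borelSpace _
  -- Haar measures: `κ` on `K₁` (image of `ds`), `μ_N` on `N` (image of `du`), `α` on `T`
  set ι' : AddCircle (2 * π) → ↥K := fun s => ⟨ι s, hKmem s⟩ with hι'
  have hι'c : Continuous ι' := (continuous_rotLift hJ).subtype_mk _
  set κ : Measure ↥K := Measure.map ι' volume with hκ
  haveI hκH : IsHaarMeasure κ := isHaarMeasure_map_rotLift hJ K hKmem hKmem'
  obtain ⟨ψ, hψc, hψadd, hψ01, hψH⟩ := exists_lineChart_real_isHaarMeasure_map hJ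
  set μN : Measure ↥(unipotentU (starRingEnd ℂ) J) := Measure.map ψ volume with hμN
  haveI : IsHaarMeasure μN := hψH
  set α : Measure ↥(torusU (starRingEnd ℂ) J) := Measure.haar with hα
  -- ★ FILE 1: the Iwasawa form of `μ`
  obtain ⟨C, hC0, hμC⟩ := exists_measure_quotient_torusU_complex_two_eq_smul_map hJ hK hKB κ α μN μ hμ
  have hCpos : (0 : ℝ) < (C : ℝ) := NNReal.coe_pos.2 (pos_iff_ne_zero.2 hC0)
  refine ⟨2 * (C : ℝ), by positivity, fun f hf hfc θ => ?_⟩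
  -- ★ FILE 2: the limit in `K × N` currency
  set F : ↥(unitaryGroupOfForm (starRingEnd ℂ) J) → E := fun g => f ((g : GL (Fin 2) ℂ) : Matrix (Fin 2) (Fin 2) ℂ) with hFdef
  have hF : Continuous F := hf.comp (Units.continuous_val.comp continuous_subtype_val)
  have hFc : HasCompactSupport F := hasCompactSupport_comp_coe hJ f hfc
  have hlim := tendsto_abs_sub_smul_integral_descConj_hypBlockGL hJ κ μN μ hK hμC F hF hFc θ
  -- the value `∫_{K₁ × N} F(e^{iθ} · k n k⁻¹)` in the coordinates `(s, u)`
  set z : ℂ := Complex.exp ((θ : ℂ) * Complex.I) with hz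
  have hz0 : z ≠ 0 := Complex.exp_ne_zero _
  have hι'm : Measurable ι' := hι'c.measurable
  have hψm : Measurable ψ := hψc.measurable
  have hΦc : Continuous fun p : ↥K × ↥(unipotentU (starRingEnd ℂ) J) =>
      F ((⟨hypBlockGL 0 θ, hypBlockGL_mem_of_eq_over hJ 0 θ⟩ : ↥(unitaryGroupOfForm (starRingEnd ℂ) J)) *
        ((p.1 : ↥(unitaryGroupOfForm (starRingEnd ℂ) J)) * (p.2 : ↥(unitaryGroupOfForm (starRingEnd ℂ) J)) *
          (p.1 : ↥(unitaryGroupOfForm (starRingEnd ℂ) J))⁻¹)) := by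
    refine hF.comp (continuous_const.mul ?_)
    exact ((continuous_subtype_val.comp continuous_fst).mul (continuous_subtype_val.comp continuous_snd)).mul
      (continuous_subtype_val.comp continuous_fst).inv
  have hpt : ∀ (s : AddCircle (2 * π)) (u : ℝ),
      F ((⟨hypBlockGL 0 θ, hypBlockGL_mem_of_eq_over hJ 0 θ⟩ : ↥(unitaryGroupOfForm (starRingEnd ℂ) J)) *
        (((ι' s : ↥K) : ↥(unitaryGroupOfForm (starRingEnd ℂ) J)) * ((ψ u : ↥(unipotentU (starRingEnd ℂ) J)) : ↥(unitaryGroupOfForm (starRingEnd ℂ) J)) *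
          ((ι' s : ↥K) : ↥(unitaryGroupOfForm (starRingEnd ℂ) J))⁻¹)) =
      f (z • ((1 : Matrix (Fin 2) (Fin 2) ℂ) + (((u : ℝ) : ℂ) * Complex.I) •
        !![Complex.I * ((Real.Angle.sin s : ℝ) : ℂ) * ((Real.Angle.cos s : ℝ) : ℂ), ((Real.Angle.cos s : ℝ) : ℂ) ^ 2;
          ((Real.Angle.sin s : ℝ) : ℂ) ^ 2, -(Complex.I * ((Real.Angle.sin s : ℝ) : ℂ) * ((Real.Angle.cos s : ℝ) : ℂ))])) := by
    intro s u
    simp only [hFdef]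
    rw [Subgroup.coe_mul, Units.val_mul, coe_hypBlockGL_zero_left, Matrix.smul_mul, Matrix.one_mul]
    change f (z • ((((ι s * ((ψ u : ↥(unipotentU (starRingEnd ℂ) J)) : ↥(unitaryGroupOfForm (starRingEnd ℂ) J)) * (ι s)⁻¹ :
      ↥(unitaryGroupOfForm (starRingEnd ℂ) J)) : GL (Fin 2) ℂ) : Matrix (Fin 2) (Fin 2) ℂ))) = _
    rw [hι, coe_rotLift_mul_unipotent_mul_inv hJ s (ψ u), hψ01]
  have hV : ∫ p : ↥K × ↥(unipotentU (starRingEnd ℂ) J),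
      F ((⟨hypBlockGL 0 θ, hypBlockGL_mem_of_eq_over hJ 0 θ⟩ : ↥(unitaryGroupOfForm (starRingEnd ℂ) J)) *
        ((p.1 : ↥(unitaryGroupOfForm (starRingEnd ℂ) J)) * (p.2 : ↥(unitaryGroupOfForm (starRingEnd ℂ) J)) *
          (p.1 : ↥(unitaryGroupOfForm (starRingEnd ℂ) J))⁻¹)) ∂(κ.prod μN) =
      ∫ q : AddCircle (2 * π) × ℝ, f (z • ((1 : Matrix (Fin 2) (Fin 2) ℂ) + (((q.2 : ℝ) : ℂ) * Complex.I) •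
        !![Complex.I * ((Real.Angle.sin q.1 : ℝ) : ℂ) * ((Real.Angle.cos q.1 : ℝ) : ℂ), ((Real.Angle.cos q.1 : ℝ) : ℂ) ^ 2;
          ((Real.Angle.sin q.1 : ℝ) : ℂ) ^ 2, -(Complex.I * ((Real.Angle.sin q.1 : ℝ) : ℂ) * ((Real.Angle.cos q.1 : ℝ) : ℂ))])) ∂(volume.prod volume) := by
    rw [hκ, hμN, Measure.map_prod_map _ _ hι'm hψm, integral_map (hι'm.prodMap hψm).aemeasurable hΦc.aestronglyMeasurable]
    refine integral_congr_ae (Eventually.of_forall fun q => ?_)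
    exact hpt q.1 q.2
  rw [hV, integral_addCircle_prod_coneChart_eq_two_smul_cone f hf hfc z hz0, smul_smul, mul_comm (C : ℝ) 2] at hlim
  exact hlim

end ConeMatching

end UnitaryGroup

end Literature.NumberTheory.Automorphic

end
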